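import Literature.NumberTheory.EllipticCurves.Smith2016.CongruentNumberSmithMatrixSelmer
import Literature.NumberTheory.EllipticCurves.TianYuanZhang2017.ScriptLOddOfRhoZero
import Literature.NumberTheory.EllipticCurves.TianYuanZhang2017.GenusFieldFamily
import Literature.NumberTheory.QuadraticFields.RedeiReichardtFourRank
import Literature.NumberTheory.EllipticCurves.HeathBrown1994.CongruentTwoSelmerOddGraphFamilies
import HarnessLib

/-!
# Smith 2016, Table 2 (Rédei), the row `d ≡ 1 (mod 4)`: `g(d) ≡ det (A | z) (mod 2)` — the parity of the genus class number `#2Cl(ℚ(√−d))` of an odd `d = p₁⋯p_k ≡ 1 (mod 4)` is the determinant of Monsky's `A` with one column replaced by Smith's `z`, PROVED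

Topic `NumberTheory/EllipticCurves`, namespace `Literature.NumberTheory.EllipticCurves.Smith2016`.
A pure proof file (theorems only); no named fact, nothing asserted.

## The source

A. Smith, *The congruent numbers have positive natural density*, arXiv:1603.08479v2 (2016)
[Smith2016CongruentDensity], §2 (chunk p0005 L26–L31): "take `g(n) ∈ 𝔽₂` to be the order of
`2Cl(ℚ(√−n))` mod `2`. It is nonzero if and only if `ℚ(√−n)` has an element in its class group of exact
order four [sic: *zero* iff]. There is an elementary method for calculating `g(n)` first given by Rédei
[ReRe33] … finding such a `d` is equivalent to solving a set of linear equations, and we can express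
`g(n)` as a determinant. We do so in Table 2"; and Proposition 2.4 (chunk p0006 L23–L34), where for a block
`S` of primes with `Σ_S yᵢ = Σ_S zᵢ = 0` (i.e. `d = ∏_S pᵢ ≡ 1 (mod 8)`) the weight `g(d)` of the
recursion `ℒ(n) = Σ g(d) ℒ(n/d)` is carried by `det Q(A, z)[S]` with
"`Q(A, z) = (A[[r], [r−1]]  z)`" — Monsky's/Smith's matrix `A` of `d` with its LAST column replaced by
the vector `z = ((2/pᵢ)₊)ᵢ`.  (Table 2 itself is not in the held text layer; the identity proved here,
`g(d) odd ⟺ det Q(A, z) = 1` for every odd square-free `d ≡ 1 (mod 4)`, is what Prop. 2.4 uses of it.)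

## The proof (Rédei–Reichardt, a tree theorem, + linear algebra over `𝔽₂`)

For `d = p₁⋯p_k ≡ 1 (mod 4)` the discriminant of `K = ℚ(√−d)` is `−4d` with prime tuple `(2; p₁, …, p_k)`
and prime discriminants `(−4; p₁*, …, p_k*)`.  By Rédei–Reichardt (`redeiReichardt_fourTwoCard_classGroup_holds`,
Li–Ma 2008 Thm. 0.4) and `odd_genusClassNumber_iff_of_redeiReichardt`, `g(d)` is odd iff the Rédei matrix
`RM(−4d)` has rank `k`.  Its rows sum to zero, so its rank is that of the `(k+1) × k` matrix of its
odd-prime columns (`rank_redeiMatrix_eq_rank_submatrix_succ`), whose entries are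
`RM(−4d)_{2, p_b} = [(2/p_b) = −1] = z_b`, `RM(−4d)_{p_a, p_b} = [(p_a/p_b) = −1] = A_{ba}` and
`RM(−4d)_{p_b, p_b} = [((d/p_b)/p_b) = −1] = A_{bb}` (the tree's `redeiMatrix_transpose_apply`: quadratic
reciprocity for the `p*`); i.e. it is `(z | A)ᵀ`.  Finally `rank (z | A) = rank (A with column c := z)` for
any `c`, because the columns of `A` sum to zero (`A·1 = 0`), and over `𝔽₂` a square matrix has full rank
iff its determinant is `1`.  Main statements: `odd_genusClassNumber_iff_det_updateCol` (any `K ≅ ℚ(√−d)`, any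
column `c`) and `odd_genusClassNumber_genusField_iff_det_updateCol` (the tree's `GenusField d`).

Cell `bsd-monsky` (prover-B g17).  AI provenance: written by an AI assistant; no human has reviewed it.

## References

* [Smith2016CongruentDensity] A. Smith, arXiv:1603.08479v2 (2016), §2 (chunk p0005 L26–L31, Table 2) and
  Prop. 2.4 (chunk p0006 L23–L34).
* [LiMa2008] Y. Li, L. Ma, Acta Arith. 134 (2008), Lemma 0.1, Def. 0.2, Thm. 0.4 (Rédei–Reichardt).
* [RedeiReichardt1934] L. Rédei, H. Reichardt, J. reine angew. Math. 170 (1934), 69–74.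
* [IrelandRosen1990] K. Ireland, M. Rosen, GTM 84, Ch. 5 §1–§2 (quadratic reciprocity, supplements).
-/

open scoped Classical

open Matrix Finset
open Literature.NumberTheory.EllipticCurves.HeathBrown1994
open Literature.NumberTheory.EllipticCurves.HeathBrown1994.Families (legendreMatrix_apply_of_ne legendreMatrix_apply_self)
open Literature.NumberTheory.EllipticCurves.MonskySelmerParity
open Literature.NumberTheory.QuadraticFields.RedeiReichardt
open Literature.NumberTheory.EllipticCurves.Tian2014 (IsQuadraticFieldOfSqrt)
open Literature.NumberTheory.EllipticCurves.TianYuanZhang2017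

namespace Literature.NumberTheory.EllipticCurves.Smith2016

/-! ## §1 Symbols: the `[· = −1]` form versus Monsky's additive symbol; multiplicativity in the top -/

/-- For a symbol with value `±1`, Rédei's bit `[(a/q) = −1]` is Monsky's/Smith's additive symbol `(a/q)₊`.
[cite: Smith2016CongruentDensity, §2 (chunk p0005 L5–L8)] -/
theorem ite_jacobiSym_eq_addLegendreSym {a : ℤ} {q : ℕ} (h : jacobiSym a q = 1 ∨ jacobiSym a q = -1) :
    (if jacobiSym a q = -1 then (1 : ZMod 2) else 0) = addLegendreSym a q := by
  rcases h with h | h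
  · rw [addLegendreSym_of_eq_one h, if_neg (by rw [h]; decide)]
  · rw [addLegendreSym_of_eq_neg_one h, if_pos h]

/-- At an odd prime `q ∤ a` the symbol `(a/q)` is `±1`. [cite: IrelandRosen1990, Ch. 5 §1 Prop. 5.1.2] -/
theorem jacobiSym_eq_one_or_neg_one_of_prime {a : ℤ} {q : ℕ} (hq : q.Prime) (ha : (a : ZMod q) ≠ 0) :
    jacobiSym a q = 1 ∨ jacobiSym a q = -1 := by
  haveI : Fact q.Prime := ⟨hq⟩
  rw [← jacobiSym.legendreSym.to_jacobiSym]
  exact legendreSym.eq_one_or_neg_one q ha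

/-- **Multiplicativity in the top argument, additively**: for a prime `q` not dividing any `f i`,
`(∏ f i / q)₊ = Σ (f i / q)₊`. [cite: IrelandRosen1990, Ch. 5 §1 Prop. 5.1.2 (multiplicativity of (·/p))] -/
theorem addLegendreSym_prod_left {ι : Type*} (s : Finset ι) (f : ι → ℕ) {q : ℕ} (hq : q.Prime)
    (hf : ∀ i ∈ s, ((f i : ℕ) : ZMod q) ≠ 0) :
    (jacobiSym ((∏ i ∈ s, f i : ℕ) : ℤ) q = 1 ∨ jacobiSym ((∏ i ∈ s, f i : ℕ) : ℤ) q = -1) ∧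
      addLegendreSym ((∏ i ∈ s, f i : ℕ) : ℤ) q = ∑ i ∈ s, addLegendreSym (f i) q := by
  induction s using Finset.induction_on with
  | empty =>
    simp only [prod_empty, sum_empty, Nat.cast_one, jacobiSym.one_left, true_or, true_and]
    exact addLegendreSym_of_eq_one (jacobiSym.one_left _)
  | insert i s hi ih =>
    have hf' : ∀ j ∈ s, ((f j : ℕ) : ZMod q) ≠ 0 := fun j hj => hf j (mem_insert_of_mem hj)
    obtain ⟨ihv, ihs⟩ := ih hf'
    have hvi : jacobiSym (f i : ℤ) q = 1 ∨ jacobiSym (f i : ℤ) q = -1 :=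
      jacobiSym_eq_one_or_neg_one_of_prime hq (by rw [Int.cast_natCast]; exact hf i (mem_insert_self i s))
    have hmul : jacobiSym (((f i * ∏ j ∈ s, f j : ℕ) : ℤ)) q =
        jacobiSym (f i : ℤ) q * jacobiSym ((∏ j ∈ s, f j : ℕ) : ℤ) q := by
      rw [Nat.cast_mul]; exact jacobiSym.mul_left _ _ _
    rw [prod_insert hi, sum_insert hi, ← ihs, addLegendreSym_def (((f i * ∏ j ∈ s, f j : ℕ) : ℤ)), hmul,
      addLegendreSym_def (f i : ℤ), addLegendreSym_def ((∏ j ∈ s, f j : ℕ) : ℤ)]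
    rcases hvi with h | h <;> rcases ihv with h' | h' <;> rw [h, h'] <;> norm_num
    decide

/-- A prime different from the prime `q` is nonzero in `ZMod q`. [cite: IrelandRosen1990, Ch. 5 §1 (Legendre symbol at p ∤ a)] -/
theorem natCast_zmod_ne_zero_of_prime_ne {q r : ℕ} (hq : q.Prime) (hr : r.Prime) (hne : r ≠ q) :
    ((r : ℕ) : ZMod q) ≠ 0 := by
  rw [Ne, ZMod.natCast_eq_zero_iff]
  exact fun h => hne ((Nat.prime_dvd_prime_iff_eq hq hr).mp h).symm

/-! ## §2 The prime tuple `(2; p₁, …, p_k)` of the discriminant `−4d`, `d = p₁⋯p_k ≡ 1 (mod 4)` -/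

section Tuple

variable {k : ℕ} (p : Fin k → ℕ)

/-- Every entry of `(2; p₁, …, p_k)` is prime. [cite: LiMa2008, Lemma 0.1 (p. 279)] -/
theorem prime_cons_two (hp : ∀ i, (p i).Prime) : ∀ i, ((Fin.cons 2 p : Fin (k + 1) → ℕ) i).Prime :=
  fun i => Fin.cases Nat.prime_two (fun a => by rw [Fin.cons_succ]; exact hp a) i

/-- `(2; p₁, …, p_k)` is injective for distinct odd `pᵢ`. [cite: LiMa2008, Lemma 0.1 (p. 279)] -/
theorem injective_cons_two (hodd : ∀ i, Odd (p i)) (hinj : Function.Injective p) :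
    Function.Injective (Fin.cons 2 p : Fin (k + 1) → ℕ) := by
  refine Fin.cons_injective_iff.mpr ⟨?_, hinj⟩
  rintro ⟨a, ha⟩
  exact ne_two_of_odd p hodd a ha

/-- `∏ (2; p₁, …, p_k) = 2d`, the shape "`∏ pᵢ = if d % 4 = 1 then 2d else d`" of the Rédei–Reichardt fact
for `d ≡ 1 (mod 4)`. [cite: LiMa2008, Lemma 0.1 (p. 279: D = −4d for d ≡ 1 (mod 4))] -/
theorem prod_cons_two (h4 : (∏ i, p i) % 4 = 1) :
    ∏ i, (Fin.cons 2 p : Fin (k + 1) → ℕ) i = if (∏ i, p i) % 4 = 1 then 2 * ∏ i, p i else ∏ i, p i := by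
  rw [if_pos h4, Fin.prod_univ_succ, Fin.cons_zero]
  simp only [Fin.cons_succ]

/-- `(2; p)_{b+1} = p_b ≠ 2`. [cite: LiMa2008, Lemma 0.1 (p. 279)] -/
theorem cons_two_succ_ne_two (hodd : ∀ i, Odd (p i)) (b : Fin k) :
    (Fin.cons 2 p : Fin (k + 1) → ℕ) b.succ ≠ 2 := by
  rw [Fin.cons_succ]; exact ne_two_of_odd p hodd b

/-- `d / p_b = ∏_{a ≠ b} p_a`. [cite: LiMa2008, Def. 0.2 (p. 279)] -/
theorem prod_div_eq_prod_erase (hp : ∀ i, (p i).Prime) (b : Fin k) :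
    (∏ i, p i) / p b = ∏ a ∈ univ.erase b, p a := by
  rw [← Finset.mul_prod_erase _ _ (mem_univ b)]
  exact Nat.mul_div_cancel_left _ (hp b).pos

/-! ### The odd-prime columns of `RM(−4d)`: `(z | A)ᵀ` -/

/-- **The odd-prime columns of the Rédei matrix of `ℚ(√−d)`, `d = p₁⋯p_k ≡ 1 (mod 4)`**: for every row `j`
of the tuple `(2; p₁, …, p_k)`, `RM(−4d)_{j, p_b}` is `z_b = (2/p_b)₊` if `j` is the prime `2`, and Monsky's
`A_{ba}` if `j` is the prime `p_a` (including `a = b`: `[((d/p_b)/p_b) = −1] = Σ_{a ≠ b} (p_a/p_b)₊ = A_bb`).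
Quadratic reciprocity for the prime discriminants `p*` (tree: `redeiMatrix_transpose_apply`).
[cite: LiMa2008, Def. 0.2 (p. 279)] [cite: Smith2016CongruentDensity, §2 (chunk p0005 L5–L31)] -/
theorem redeiMatrix_cons_two_apply_succ (hp : ∀ i, (p i).Prime) (hodd : ∀ i, Odd (p i))
    (hinj : Function.Injective p) (h4 : (∏ i, p i) % 4 = 1) (j : Fin (k + 1)) (b : Fin k) :
    redeiMatrix (∏ i, p i) (Fin.cons 2 p) j b.succ =
      Fin.cases (addLegendreSym 2 (p b)) (fun a => legendreMatrix p b a) j := by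
  have hq := prime_cons_two p hp
  have hqinj := injective_cons_two p hodd hinj
  have hqprod := prod_cons_two p h4
  have hp2 := ne_two_of_odd p hodd
  rw [redeiMatrix_transpose_apply hq hqinj hqprod (cons_two_succ_ne_two p hodd b) j]
  refine Fin.cases ?_ (fun a => ?_) j
  · -- the prime `2`: `[(2/p_b) = −1] = z_b`
    rw [if_neg (Fin.succ_ne_zero b).symm, Fin.cases_zero, Fin.cons_zero, Fin.cons_succ]
    refine ite_jacobiSym_eq_addLegendreSym (jacobiSym_eq_one_or_neg_one_of_prime (hp b) ?_)
    rw [show ((2 : ℕ) : ℤ) = ((2 : ℕ) : ℤ) from rfl, Int.cast_natCast]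
    exact natCast_zmod_ne_zero_of_prime_ne (hp b) Nat.prime_two (hp2 b).symm
  · rw [Fin.cases_succ, Fin.cons_succ]
    by_cases hab : a = b
    · -- the diagonal: `[((d/p_b)/p_b) = −1] = Σ_{a ≠ b} (p_a/p_b)₊ = A_bb`
      subst hab
      rw [if_pos rfl, prod_div_eq_prod_erase p hp a, legendreMatrix_apply_self]
      have hf : ∀ i ∈ univ.erase a, ((p i : ℕ) : ZMod (p a)) ≠ 0 := fun i hi =>
        natCast_zmod_ne_zero_of_prime_ne (hp a) (hp i) fun h => (ne_of_mem_erase hi) (hinj h)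
      obtain ⟨hval, hsum⟩ := addLegendreSym_prod_left (univ.erase a) p (hp a) hf
      rw [ite_jacobiSym_eq_addLegendreSym hval, hsum]
      exact Finset.sum_congr rfl fun i hi => by rw [legendreMatrix_apply_of_ne p (ne_of_mem_erase hi).symm]
    · rw [if_neg (fun h => hab (Fin.succ_inj.mp h)), Fin.cons_succ, legendreMatrix_apply_of_ne p (Ne.symm hab)]
      refine ite_jacobiSym_eq_addLegendreSym (jacobiSym_eq_one_or_neg_one_of_prime (hp b) ?_)
      rw [Int.cast_natCast]
      exact natCast_zmod_ne_zero_of_prime_ne (hp b) (hp a) fun h => hab (hinj h)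

/-! ## §3 Ranks: `rank RM(−4d) = rank (z | A) = rank (A with a column replaced by z)` -/

/-- **The rows of `RM(D)` sum to zero, so dropping the column of the prime `2` does not change the rank**:
`rank RM(−4d) = rank RM(−4d)[·, odd primes]`. [cite: LiMa2008, Def. 0.2 (p. 279: r_ii = Σ_{j≠i} r_ij)]
[cite: Stevenhagen1995RedeiMatrices, §2 (after Thm. 1: "a singular matrix")] -/
theorem rank_redeiMatrix_eq_rank_submatrix_succ (n : ℕ) (q : Fin (k + 1) → ℕ) :
    (redeiMatrix n q).rank = ((redeiMatrix n q).submatrix id Fin.succ).rank := by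
  refine le_antisymm ?_ (rank_submatrix_le _ _ _)
  -- `RM = N * Q` with `Q = (1 | I)`: column `0` of `RM` is the sum of the others
  set N := (redeiMatrix n q).submatrix id Fin.succ with hN
  let Q : Matrix (Fin k) (Fin (k + 1)) (ZMod 2) :=
    Matrix.of fun a j => Fin.cases (1 : ZMod 2) (fun c => if a = c then 1 else 0) j
  have hRM : redeiMatrix n q = N * Q := by
    ext i j
    rw [Matrix.mul_apply]
    refine Fin.cases ?_ (fun c => ?_) j
    · -- column of `2`: `Σ_a RM i (a+1) = RM i 0`
      have h0 := congr_fun (redeiMatrix_mulVec_one n q) i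
      rw [Matrix.mulVec, dotProduct, Pi.zero_apply, Fin.sum_univ_succ] at h0
      simp only [mul_one] at h0
      simp only [hN, submatrix_apply, id, Matrix.of_apply, Fin.cases_zero, mul_one, Q]
      have : ∀ x y : ZMod 2, x + y = 0 → x = y := by decide
      exact this _ _ h0
    · simp only [hN, submatrix_apply, id, Matrix.of_apply, Fin.cases_succ, mul_ite, mul_one, mul_zero, Q]
      rw [Finset.sum_ite_eq' univ c, if_pos (mem_univ c)]
  calc (redeiMatrix n q).rank = (N * Q).rank := by rw [← hRM]
    _ ≤ N.rank := rank_mul_le_left _ _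

/-- **The columns of `A` sum to zero (`A·1 = 0`), so `rank (z | A) = rank (A with column c := z)`** for
every `c`: here `(z | A)` is given as a `k × (k+1)` matrix `Z` with `Z_{b,0} = z_b`, `Z_{b,a+1} = A_{ba}`.
[cite: Smith2016CongruentDensity, Prop. 2.4 (chunk p0006 L23–L30: Q(A,z) = (A[[r],[r−1]] z))]
[cite: HeathBrown1994SelmerCongruentII, Appendix (Monsky), typescript p. 39 L13–L26 (A_ii = Σ_{j≠i} A_ij)] -/
theorem rank_cons_col_eq_rank_updateCol (z : Fin k → ZMod 2) (c : Fin k) :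
    (Matrix.of fun (b : Fin k) (j : Fin (k + 1)) =>
        Fin.cases (motive := fun _ => ZMod 2) (z b) (fun a => legendreMatrix p b a) j).rank =
      ((legendreMatrix p).updateCol c z).rank := by
  set Z : Matrix (Fin k) (Fin (k + 1)) (ZMod 2) := Matrix.of fun (b : Fin k) (j : Fin (k + 1)) =>
    Fin.cases (motive := fun _ => ZMod 2) (z b) (fun a => legendreMatrix p b a) j with hZ
  refine le_antisymm ?_ ?_
  · -- `Z = U * R`: column `0` of `Z` is column `c` of `U`, column `a+1 ≠ c+1` is column `a` of `U`, and
    -- column `c+1` of `Z` (= column `c` of `A`) is the sum of the OTHER columns of `A` (row sums vanish)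
    let R : Matrix (Fin k) (Fin (k + 1)) (ZMod 2) := Matrix.of fun a j =>
      Fin.cases (motive := fun _ => ZMod 2) (if a = c then 1 else 0)
        (fun e => if e = c then (if a = c then 0 else 1) else (if a = e then 1 else 0)) j
    have hZU : Z = (legendreMatrix p).updateCol c z * R := by
      ext b j
      rw [Matrix.mul_apply]
      refine Fin.cases ?_ (fun e => ?_) j
      · simp only [hZ, Matrix.of_apply, Fin.cases_zero, mul_ite, mul_one, mul_zero, R]
        rw [Finset.sum_ite_eq' univ c, if_pos (mem_univ c), updateCol_self]
      · simp only [hZ, Matrix.of_apply, Fin.cases_succ, R]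
        by_cases hec : e = c
        · subst hec
          simp only [if_true, mul_ite, mul_zero, mul_one]
          -- `Σ_{a ≠ e} U b a = Σ_{a ≠ e} A b a = A b e`
          have hrow := congr_fun (MonskySelmerParity.legendreMatrix_mulVec_one p) b
          rw [Matrix.mulVec, dotProduct, Pi.zero_apply] at hrow
          simp only [Pi.one_apply, mul_one] at hrow
          rw [← Finset.add_sum_erase _ _ (mem_univ e)] at hrow
          have hsum : ∑ a, (if a = e then (0 : ZMod 2) else (legendreMatrix p).updateCol e z b a) =
              ∑ a ∈ univ.erase e, legendreMatrix p b a := by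
            rw [← Finset.add_sum_erase _ _ (mem_univ e), if_pos rfl, zero_add]
            refine Finset.sum_congr rfl fun a ha => ?_
            rw [if_neg (ne_of_mem_erase ha), updateCol_ne (ne_of_mem_erase ha)]
          rw [hsum]
          have : ∀ x y : ZMod 2, x + y = 0 → y = x := by decide
          exact (this _ _ hrow).symm
        · simp only [hec, if_false, mul_ite, mul_one, mul_zero]
          rw [Finset.sum_ite_eq' univ e, if_pos (mem_univ e), updateCol_ne hec]
    calc Z.rank = ((legendreMatrix p).updateCol c z * R).rank := by rw [← hZU]
      _ ≤ ((legendreMatrix p).updateCol c z).rank := rank_mul_le_left _ _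
  · -- `U` is the column-submatrix of `Z` picking column `0` for `c` and column `a+1` for `a ≠ c`
    have hUZ : (legendreMatrix p).updateCol c z =
        Z.submatrix id (fun a => if a = c then (0 : Fin (k + 1)) else a.succ) := by
      ext b a
      simp only [hZ, submatrix_apply, id, Matrix.of_apply, updateCol_apply]
      by_cases hac : a = c
      · rw [if_pos hac, if_pos hac, Fin.cases_zero]
      · rw [if_neg hac, if_neg hac, Fin.cases_succ]
    calc ((legendreMatrix p).updateCol c z).rank
        = (Z.submatrix id (fun a => if a = c then (0 : Fin (k + 1)) else a.succ)).rank := by rw [← hUZ]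
      _ ≤ Z.rank := rank_submatrix_le _ _ _

/-- **`rank RM(−4d) = rank (A with column c := z)`** for `d = p₁⋯p_k ≡ 1 (mod 4)` and every column `c`.
[cite: Smith2016CongruentDensity, §2 (chunk p0005 L26–L31) and Prop. 2.4 (chunk p0006 L23–L30)]
[cite: LiMa2008, Def. 0.2, Thm. 0.4] -/
theorem rank_redeiMatrix_cons_two_eq_rank_updateCol (hp : ∀ i, (p i).Prime) (hodd : ∀ i, Odd (p i))
    (hinj : Function.Injective p) (h4 : (∏ i, p i) % 4 = 1) (c : Fin k) :
    (redeiMatrix (∏ i, p i) (Fin.cons 2 p)).rank =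
      ((legendreMatrix p).updateCol c fun i => addLegendreSym 2 (p i)).rank := by
  rw [rank_redeiMatrix_eq_rank_submatrix_succ, ← rank_transpose,
    ← rank_cons_col_eq_rank_updateCol p (fun i => addLegendreSym 2 (p i)) c]
  congr 1
  ext b j
  rw [transpose_apply, submatrix_apply, id, Matrix.of_apply,
    redeiMatrix_cons_two_apply_succ p hp hodd hinj h4 j b]

end Tuple

/-! ## §4 Smith's Table 2, row `d ≡ 1 (mod 4)`: `g(d)` odd `⟺ det (A with a column := z) = 1` -/

section Genus

variable {k : ℕ} (p : Fin k → ℕ)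

/-- **`g(d) ≡ det Q(A, z) (mod 2)`** (Smith's Table 2 via Rédei–Reichardt, a tree theorem): for
`d = p₁⋯p_k ≡ 1 (mod 4)` a product of distinct odd primes, any `K` with `[K : ℚ] = 2`, `−d ∈ K²`, and any
column index `c`, the genus class number `#2Cl(K)` is odd iff `det (A with column c replaced by z) = 1`
over `𝔽₂` (`A` Monsky's matrix of `d`, `zᵢ = (2/pᵢ)₊`).
[cite: Smith2016CongruentDensity, §2 (chunk p0005 L26–L31: "we can express g(n) as a determinant … Table 2") and Prop. 2.4 (chunk p0006 L23–L34)]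
[cite: LiMa2008, Thm. 0.4 (Rédei–Reichardt)] -/
theorem odd_genusClassNumber_iff_det_updateCol (hp : ∀ i, (p i).Prime) (hodd : ∀ i, Odd (p i))
    (hinj : Function.Injective p) (h4 : (∏ i, p i) % 4 = 1) (c : Fin k)
    (K : Type) [Field K] [NumberField K] (hK : IsQuadraticFieldOfSqrt K (-((∏ i, p i : ℕ) : ℤ))) :
    Odd (genusClassNumber K) ↔ ((legendreMatrix p).updateCol c fun i => addLegendreSym 2 (p i)).det = 1 := by
  rw [odd_genusClassNumber_iff_of_redeiReichardt redeiReichardt_fourTwoCard_classGroup_holds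
      (prime_cons_two p hp) (injective_cons_two p hodd hinj) (prod_cons_two p h4) K hK,
    det_eq_one_iff_rank_eq_card, Fintype.card_fin,
    ← rank_redeiMatrix_cons_two_eq_rank_updateCol p hp hodd hinj h4 c]
  have hle := rank_redeiMatrix_le (∏ i, p i) (Fin.cons 2 p) (Nat.succ_pos k)
  omega

/-- **Smith's Table 2, row `d ≡ 1 (mod 4)`, on the tree's genus fields**: for `d = p₁⋯p_k ≡ 1 (mod 4)`,
`g(d) = #2Cl(ℚ(√−d))` (`genusClassNumber (GenusField d)`) is odd iff `det (A with column c := z) = 1`.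
[cite: Smith2016CongruentDensity, §2 (chunk p0005 L26–L31) and Prop. 2.4 (chunk p0006 L23–L34)]
[cite: LiMa2008, Thm. 0.4 (Rédei–Reichardt)] -/
theorem odd_genusClassNumber_genusField_iff_det_updateCol (hp : ∀ i, (p i).Prime)
    (hodd : ∀ i, Odd (p i)) (hinj : Function.Injective p) (h4 : (∏ i, p i) % 4 = 1) (c : Fin k) :
    Odd (genusClassNumber (GenusField (∏ i, p i))) ↔
      ((legendreMatrix p).updateCol c fun i => addLegendreSym 2 (p i)).det = 1 :=
  odd_genusClassNumber_iff_det_updateCol p hp hodd hinj h4 c (GenusField (∏ i, p i))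
    (isQuadraticFieldOfSqrt_genusField (Nat.pos_of_ne_zero
      (Squarefree.ne_zero (squarefree_prod_of_injective p hp hinj))))

/-- **A prime `p ≡ 1 (mod 8)` has `g(p)` even** (`k = 1`: `A = (0)`, `z = ((2/p)₊) = (0)`, `det (z) = 0`;
classically: `Cl(ℚ(√−p))` has an element of order `4` iff `p ≡ 1 (mod 8)`).
[cite: Smith2016CongruentDensity, §2 (chunk p0005 L26–L31)] [cite: LiMa2008, Thm. 0.4] -/
theorem even_genusClassNumber_genusField_prime {q : ℕ} (hq : q.Prime) (h8 : q % 8 = 1) :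
    Even (genusClassNumber (GenusField q)) := by
  have hq2 : q ≠ 2 := by rintro rfl; norm_num at h8
  have hodd : ∀ i, Odd ((![q] : Fin 1 → ℕ) i) := fun i => by
    fin_cases i; exact hq.odd_of_ne_two hq2
  have hprime : ∀ i, ((![q] : Fin 1 → ℕ) i).Prime := fun i => by fin_cases i; exact hq
  have hq1 : (∏ i, (![q] : Fin 1 → ℕ) i) = q := by
    rw [Fin.prod_univ_succ, Fin.prod_univ_zero, mul_one]; rfl
  have h4 : (∏ i, (![q] : Fin 1 → ℕ) i) % 4 = 1 := by rw [hq1]; omega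
  have h := odd_genusClassNumber_iff_det_updateCol ![q] hprime hodd (Function.injective_of_subsingleton _)
    h4 0 (GenusField q) (by rw [hq1]; exact isQuadraticFieldOfSqrt_genusField hq.one_lt.le)
  have h2 : jacobiSym 2 q = 1 := by
    have hq2' : q % 2 = 1 := by omega
    rw [jacobiSym.at_two (hq.odd_of_ne_two hq2), ZMod.χ₈_nat_eq_if_mod_eight]
    simp [hq2', h8]
  rw [← Nat.not_odd_iff_even, h, Matrix.det_fin_one, updateCol_self]
  change ¬ addLegendreSym 2 q = 1
  rw [addLegendreSym_of_eq_one h2]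
  exact zero_ne_one

end Genus

end Literature.NumberTheory.EllipticCurves.Smith2016
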